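import Summits.QuantumFields.BalabanUV.Beta.EriceRemainderEnclosureHistoryAutonomyComparisonShapeProfile

/-!
# EriceRemainderEnclosureHistoryAutonomyComparisonShapeProfileEnd — (E59b) THE PROFILE CONDITION AS NAMED PROFILE FACTS, AND THE SATURATING LINEAR MEMORY
# `b + Σ_{k<K} L_k·min(u_k, σ)`: `profileSum_le_two_of_window` (all memory ages within a factor 3), `profileSum_le_two_of_markov` (`Σ_k L_k ≤ 3·L_0`), and
# comparison at ANY size for the saturating memory under the profile condition ∕ in every window of factor 3 (`le_of_isotone_excess_min_profile`,
# `le_of_isotone_excess_min_window`)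

Cell `pub-balaban`, β-function sub-cell, BINDER row D4 «RemainderConst leaves for Bałaban's split» (`HOME/BINDER-OWNERS.md`; owner lineage `b2b-balaban-beta-an4`;
this file by co-owner #2 lineage `b2b-balaban-beta-d4-p2`, generation 51), β-FLOW TEAM duty (1), FREEZE (0) honoured (def-free; (E59a)'s
`le_of_isotone_excess_shape_profile` BY NAME; the functional is the displayed lambda term `fun u ↦ b + Σ_{k<K} L_k·min(u_k, σ)`; nothing restated — the two
profile facts of §1 were proved INLINE inside (E58c)'s `le_of_isotone_excess_affine_window` ∕ `…_markov` and are stated here once as lemmas on the profile `L`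
alone, so that every class governed by the condition (affine (E58b), shapes (E59a), future ones) can cite them).  Sequel of (E59a) `…ComparisonShapeProfile`.

HONEST FRAMING (page 1, verbatim and binding).  *"Discharging BetaPertH makes Bałaban's UV stability UNCONDITIONAL — a real constructive-QFT result; it is
NOT the continuum limit and NOT the Clay problem."*  THIS FILE DISCHARGES NOTHING OF THE KIND.  Elementary real analysis about ABSTRACT functionals on a box
]0,γ]^ℕ — hypotheses of a census, not facts; whether Bałaban's (1.22) limit functional has a saturating (or any) linear memory is NOT PRINTED ([I] p. 298;
GAPS G-t4-U2-1∕-2) and NOT asserted; `min(u, σ)` is an ILLUSTRATION of the sub-homogeneous class.  Row D4 class UNCHANGED (critical-path width 0; instance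
0∕1; D4 DISCHARGE NO DATE).  HONEST DEPENDENCY: continuum YM on T⁴ ⇐ BetaPertH ∧ nine spine estimates (0/9 proved); BetaPertH ⇐ (D1) ∧ (D4) ∧ CAP+tail;
G-an2-4 gates asym, D1 and NE2/3/4.

THE POINT (census sense (α)).  §1: the profile condition `Σ_{j<K} L_j ∕ P_j ≤ 2`, `P_j = Σ_{k<K} L_k·√(j∕(j+k))`, holds (i) whenever the weights `L_k`,
`k ≥ 1`, vanish outside a window `[K₀, 3K₀]` (`K₀ ≥ 1`; `j∕(j+k) ≥ 1∕4` there and `= 1` against `k = 0`, so `P_j ≥ ½·Σ_k L_k` for every memory age of the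
window, while the `j = 0` summand is `0`) — WHATEVER the sizes and the Markov weight `L_0`; (ii) whenever `Σ_{k<K} L_k ≤ 3·L_0` (`P_j ≥ L_0` for `j ≥ 1`) —
WHATEVER the ages.  §2: the saturating shape `ψ(u) = min(u, σ)` (`σ > 0`) is `≥ 0`, non-decreasing, sub-homogeneous and `1`-Lipschitz on ]0,γ], so (E59a)
applies: `b + Σ_k L_k·min(u_k, σ)` compares at ANY size under every isotone excess with a zeroth moment when the profile passes, in particular in every window
of factor 3 (§2 `le_of_isotone_excess_min_window`) — a memory that reads each past coupling linearly up to a cap.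

WHAT IS PROVED ([folklore]; 0 `def`, 0 sorry).  §1 **`profileSum_le_two_of_window`**, **`profileSum_le_two_of_markov`**.  §2 `min_shape_nonneg`, `min_shape_mono`,
`min_shape_subhom`, `min_shape_lipschitz`, **`le_of_isotone_excess_min_profile`**, **`le_of_isotone_excess_min_window`**.
-/
noncomputable section
open Finset Set

namespace Summit.QuantumFields.BalabanUV.Beta.EriceRemainderEnclosureHistoryAutonomyComparisonShapeProfileEnd

open Literature.MathematicalPhysics.QuantumFieldTheory.Balaban1983to89
open Literature.MathematicalPhysics.QuantumFieldTheory.Balaban1983to89.T4BetaStationary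
open Literature.MathematicalPhysics.QuantumFieldTheory.Balaban1983to89.T4BetaFlowWellPosed
open Summit.QuantumFields.BalabanUV.Beta.EriceRemainderEnclosureHistoryAutonomyComparisonShapeProfile (le_of_isotone_excess_shape_profile)

variable {B' : (ℕ → ℝ) → ℝ} {M' γ b σ : ℝ} {L : ℕ → ℝ} {K : ℕ} {h h' : ℕ → ℝ}

/-! ## §1 The profile condition from the profile alone: windows of factor 3, Markov-dominated profiles -/

/-- **ALL MEMORY AGES WITHIN A FACTOR 3 ⟹ THE PROFILE CONDITION**: if `L ≥ 0` and `L_k = 0` for every `k ≥ 1` outside `[K₀, 3K₀]` (`K₀ ≥ 1`), then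
`Σ_{j<K} L_j ∕ P_j ≤ 2`, `P_j = Σ_{k<K} L_k·√(j∕(j+k))` (the `j = 0` summand reads `0`; `P_j ≥ ½·Σ_k L_k` for the ages of the window). [folklore] -/
theorem profileSum_le_two_of_window {K₀ : ℕ} (hL : ∀ k, 0 ≤ L k) (hK₀ : 1 ≤ K₀) (hwin : ∀ k, k ≠ 0 → L k ≠ 0 → K₀ ≤ k ∧ k ≤ 3 * K₀) :
    ∑ j ∈ range K, L j / ∑ k ∈ range K, L k * Real.sqrt ((j : ℝ) / ((j : ℝ) + k)) ≤ 2 := by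
  set T : ℝ := ∑ k ∈ range K, L k with hT_def
  have hT0 : 0 ≤ T := sum_nonneg fun k _ => hL k
  have hterm : ∀ i ∈ range K, L i / ∑ k ∈ range K, L k * Real.sqrt ((i : ℝ) / ((i : ℝ) + k)) ≤ 2 * L i / T := by
    intro i hi
    rcases (hL i).eq_or_lt with hLi | hLi
    · rw [← hLi]; simp
    have hTpos : 0 < T := lt_of_lt_of_le hLi (single_le_sum (f := L) (fun k _ => hL k) hi)
    rcases Nat.eq_zero_or_pos i with rfl | hipos
    · have hP0 : ∑ k ∈ range K, L k * Real.sqrt (((0 : ℕ) : ℝ) / (((0 : ℕ) : ℝ) + k)) = 0 :=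
        sum_eq_zero fun k _ => by simp
      rw [hP0, div_zero]; positivity
    have hwi := hwin i hipos.ne' hLi.ne'
    have hir : (K₀ : ℝ) ≤ i := by exact_mod_cast hwi.1
    have hK₀r : (1 : ℝ) ≤ K₀ := by exact_mod_cast hK₀
    have hPi : T / 2 ≤ ∑ k ∈ range K, L k * Real.sqrt ((i : ℝ) / ((i : ℝ) + k)) := by
      rw [hT_def, sum_div]
      refine sum_le_sum fun k _ => ?_
      rcases (hL k).eq_or_lt with hLk | hLk
      · rw [← hLk]; simp
      have hquarter : (1 : ℝ) / 4 ≤ (i : ℝ) / ((i : ℝ) + k) := by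
        rcases Nat.eq_zero_or_pos k with rfl | hkpos
        · rw [Nat.cast_zero, add_zero, div_self (by linarith)]; norm_num
        have hwk := hwin k hkpos.ne' hLk.ne'
        have hkr : (k : ℝ) ≤ 3 * K₀ := by exact_mod_cast hwk.2
        rw [div_le_div_iff₀ (by norm_num) (by linarith [hir, hK₀r, (Nat.cast_nonneg k : (0:ℝ) ≤ k)])]; nlinarith
      have hhalf : (1 : ℝ) / 2 ≤ Real.sqrt ((i : ℝ) / ((i : ℝ) + k)) := by
        rw [show (1 : ℝ) / 2 = Real.sqrt ((1 / 2) ^ 2) by rw [Real.sqrt_sq (by norm_num)]]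
        exact Real.sqrt_le_sqrt (by norm_num at hquarter ⊢; linarith)
      calc L k / 2 = L k * (1 / 2) := by ring
        _ ≤ L k * Real.sqrt ((i : ℝ) / ((i : ℝ) + k)) := mul_le_mul_of_nonneg_left hhalf (hL k)
    rw [div_le_div_iff₀ (lt_of_lt_of_le (half_pos hTpos) hPi) hTpos]
    nlinarith [hPi, hLi.le]
  calc ∑ i ∈ range K, L i / ∑ k ∈ range K, L k * Real.sqrt ((i : ℝ) / ((i : ℝ) + k))
      ≤ ∑ i ∈ range K, 2 * L i / T := sum_le_sum hterm
    _ = 2 * T / T := by rw [hT_def, ← sum_div, mul_sum]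
    _ ≤ 2 := by
        rcases hT0.eq_or_lt with hT | hT
        · rw [← hT]; simp
        · rw [mul_div_assoc, div_self hT.ne', mul_one]

/-- **MARKOV-DOMINATED PROFILES ⟹ THE PROFILE CONDITION**: if `L ≥ 0` and `Σ_{k<K} L_k ≤ 3·L_0`, then `Σ_{j<K} L_j ∕ P_j ≤ 2` (`P_j ≥ L_0` for `j ≥ 1`,
the `j = 0` summand reads `0`) — WHATEVER the ages. [folklore] -/
theorem profileSum_le_two_of_markov (hL : ∀ k, 0 ≤ L k) (hdom : ∑ k ∈ range K, L k ≤ 3 * L 0) :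
    ∑ j ∈ range K, L j / ∑ k ∈ range K, L k * Real.sqrt ((j : ℝ) / ((j : ℝ) + k)) ≤ 2 := by
  rcases Nat.eq_zero_or_pos K with rfl | hKpos
  · simp
  have h0K : 0 ∈ range K := mem_range.mpr hKpos
  rcases (hL 0).eq_or_lt with hL0 | hL0
  · have hall : ∀ k ∈ range K, L k = 0 := by
      have hs : ∑ k ∈ range K, L k = 0 :=
        le_antisymm (by rw [← hL0, mul_zero] at hdom; exact hdom) (sum_nonneg fun k _ => hL k)
      exact (sum_eq_zero_iff_of_nonneg fun k _ => hL k).mp hs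
    rw [sum_eq_zero fun i hi => by rw [hall i hi, zero_div]]
    norm_num
  have hterm : ∀ i ∈ range K, L i / ∑ k ∈ range K, L k * Real.sqrt ((i : ℝ) / ((i : ℝ) + k)) ≤
      (if i = 0 then 0 else L i / L 0) := by
    intro i _
    rcases Nat.eq_zero_or_pos i with rfl | hipos
    · have hP0 : ∑ k ∈ range K, L k * Real.sqrt (((0 : ℕ) : ℝ) / (((0 : ℕ) : ℝ) + k)) = 0 :=
        sum_eq_zero fun k _ => by simp
      rw [hP0]; simp
    rw [if_neg hipos.ne']
    have hir : (0 : ℝ) < i := by exact_mod_cast hipos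
    have hPi : L 0 ≤ ∑ k ∈ range K, L k * Real.sqrt ((i : ℝ) / ((i : ℝ) + k)) := by
      have h1 : L 0 * Real.sqrt ((i : ℝ) / ((i : ℝ) + ((0 : ℕ) : ℝ))) = L 0 := by
        rw [Nat.cast_zero, add_zero, div_self hir.ne', Real.sqrt_one, mul_one]
      rw [← h1]
      exact single_le_sum (f := fun k => L k * Real.sqrt ((i : ℝ) / ((i : ℝ) + k)))
        (fun k _ => mul_nonneg (hL k) (Real.sqrt_nonneg _)) h0K
    exact div_le_div_of_nonneg_left (hL i) hL0 hPi
  refine (sum_le_sum hterm).trans ?_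
  have e1 := (sum_erase_add (range K) (fun i => if i = 0 then (0 : ℝ) else L i / L 0) h0K).symm
  have e2 := (sum_erase_add (range K) (fun i => L i / L 0) h0K).symm
  have e3 : ∑ i ∈ (range K).erase 0, (if i = 0 then (0 : ℝ) else L i / L 0) = ∑ i ∈ (range K).erase 0, L i / L 0 :=
    sum_congr rfl fun i hi => by rw [if_neg (mem_erase.mp hi).1]
  rw [e1, e3, if_pos rfl, add_zero]
  have e4 : ∑ i ∈ (range K).erase 0, L i / L 0 = (∑ i ∈ range K, L i) / L 0 - 1 := by
    rw [sum_div, e2, div_self hL0.ne']; ring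
  rw [e4, div_sub_one hL0.ne', div_le_iff₀ hL0]
  linarith

/-! ## §2 The saturating linear memory `b + Σ_{k<K} L_k·min(u_k, σ)` -/

/-- `min(x, σ) ≥ 0` for `x > 0`, `σ > 0`. [folklore] -/
theorem min_shape_nonneg (hσ : 0 < σ) : ∀ x : ℝ, 0 < x → x ≤ γ → 0 ≤ min x σ :=
  fun _ hx _ => le_min hx.le hσ.le

/-- `x ↦ min(x, σ)` is non-decreasing. [folklore] -/
theorem min_shape_mono : ∀ x x' : ℝ, 0 < x → x ≤ x' → x' ≤ γ → min x σ ≤ min x' σ :=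
  fun _ _ _ hxx' _ => min_le_min_right σ hxx'

/-- `x ↦ min(x, σ)` is SUB-HOMOGENEOUS for `σ ≥ 0`: `s·min(x, σ) = min(s·x, s·σ) ≤ min(s·x, σ)` for `0 ≤ s ≤ 1`. [folklore] -/
theorem min_shape_subhom (hσ : 0 ≤ σ) : ∀ s x : ℝ, 0 ≤ s → s ≤ 1 → 0 < x → x ≤ γ → s * min x σ ≤ min (s * x) σ := by
  intro s x hs hs1 _ _
  rw [mul_min_of_nonneg x σ hs]
  exact min_le_min_left (s * x) (mul_le_of_le_one_left hσ hs1)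

/-- `x ↦ min(x, σ)` is `1`-Lipschitz. [folklore] -/
theorem min_shape_lipschitz : ∀ x x' : ℝ, 0 < x → x ≤ γ → 0 < x' → x' ≤ γ → |min x σ - min x' σ| ≤ 1 * |x - x'| := by
  intro x x' _ _ _ _
  rw [one_mul]
  refine (abs_min_sub_min_le_max x σ x' σ).trans ?_
  rw [sub_self, abs_zero]
  exact max_le le_rfl (abs_nonneg _)

/-- **THE SATURATING LINEAR MEMORY `B(u) = b + Σ_{k<K} L_k·min(u_k, σ)` COMPARES AT ANY SIZE UNDER THE PROFILE CONDITION** (`b > 0`, `σ > 0`, `L_k ≥ 0` of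
ANY sizes, `Σ_{j<K} L_j ∕ P_j ≤ 2`): for every `B′ ≥ B` with a zeroth moment and an ISOTONE excess, ANY box solutions from one pin satisfy `h′ ≤ h` at
every scale. [folklore] -/
theorem le_of_isotone_excess_min_profile {p : ℝ} (hL : ∀ k, 0 ≤ L k) (hb : 0 < b) (hσ : 0 < σ)
    (hP : ∑ j ∈ range K, L j / ∑ k ∈ range K, L k * Real.sqrt ((j : ℝ) / ((j : ℝ) + k)) ≤ 2)
    (hB' : ∀ u u' : ℕ → ℝ, SeqBox γ u → SeqBox γ u' → ∀ D : ℝ, (∀ j, |u j - u' j| ≤ D) → |B' u - B' u'| ≤ M' * D) (hM' : 0 ≤ M')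
    (hexc : ∀ u, SeqBox γ u → (fun w : ℕ → ℝ => b + ∑ k ∈ range K, L k * min (w k) σ) u ≤ B' u)
    (hDmono : ∀ u v : ℕ → ℝ, SeqBox γ u → SeqBox γ v → (∀ j, u j ≤ v j) →
      B' u - (fun w : ℕ → ℝ => b + ∑ k ∈ range K, L k * min (w k) σ) u ≤ B' v - (fun w : ℕ → ℝ => b + ∑ k ∈ range K, L k * min (w k) σ) v)
    (hp : 0 < p) (hpγ : p ≤ γ) (hh : SeqBox γ h) (hf : MemFlow (fun w : ℕ → ℝ => b + ∑ k ∈ range K, L k * min (w k) σ) p h)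
    (hh' : SeqBox γ h') (hf' : MemFlow B' p h') (j : ℕ) : h' j ≤ h j :=
  le_of_isotone_excess_shape_profile (ψ := fun x : ℝ => min x σ) hL hb zero_le_one (min_shape_nonneg hσ) min_shape_mono
    (min_shape_subhom hσ.le) min_shape_lipschitz hP hB' hM' hexc hDmono hp hpγ hh hf hh' hf' j

/-- **… IN PARTICULAR IN EVERY WINDOW OF FACTOR 3**: if the memory weights `L_k`, `k ≥ 1`, vanish outside `[K₀, 3K₀]` (`K₀ ≥ 1`; Markov weight `L_0` free),
the saturating memory `b + Σ_k L_k·min(u_k, σ)` compares under every isotone excess with a zeroth moment — WHATEVER the sizes `L_k` and the cap `σ`. [folklore] -/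
theorem le_of_isotone_excess_min_window {p : ℝ} {K₀ : ℕ} (hL : ∀ k, 0 ≤ L k) (hb : 0 < b) (hσ : 0 < σ) (hK₀ : 1 ≤ K₀)
    (hwin : ∀ k, k ≠ 0 → L k ≠ 0 → K₀ ≤ k ∧ k ≤ 3 * K₀)
    (hB' : ∀ u u' : ℕ → ℝ, SeqBox γ u → SeqBox γ u' → ∀ D : ℝ, (∀ j, |u j - u' j| ≤ D) → |B' u - B' u'| ≤ M' * D) (hM' : 0 ≤ M')
    (hexc : ∀ u, SeqBox γ u → (fun w : ℕ → ℝ => b + ∑ k ∈ range K, L k * min (w k) σ) u ≤ B' u)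
    (hDmono : ∀ u v : ℕ → ℝ, SeqBox γ u → SeqBox γ v → (∀ j, u j ≤ v j) →
      B' u - (fun w : ℕ → ℝ => b + ∑ k ∈ range K, L k * min (w k) σ) u ≤ B' v - (fun w : ℕ → ℝ => b + ∑ k ∈ range K, L k * min (w k) σ) v)
    (hp : 0 < p) (hpγ : p ≤ γ) (hh : SeqBox γ h) (hf : MemFlow (fun w : ℕ → ℝ => b + ∑ k ∈ range K, L k * min (w k) σ) p h)
    (hh' : SeqBox γ h') (hf' : MemFlow B' p h') (j : ℕ) : h' j ≤ h j :=
  le_of_isotone_excess_min_profile hL hb hσ (profileSum_le_two_of_window hL hK₀ hwin) hB' hM' hexc hDmono hp hpγ hh hf hh' hf' j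

end Summit.QuantumFields.BalabanUV.Beta.EriceRemainderEnclosureHistoryAutonomyComparisonShapeProfileEnd

end
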